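import Literature.NumberTheory.EllipticCurves.CongruentNumberOddMonskySelmerKernelRelations
import Literature.NumberTheory.EllipticCurves.CongruentNumberMonskySelmerCandidates
import Literature.NumberTheory.EllipticCurves.CongruentNumberTwoDescentLocalOdd
import HarnessLib

/-!
# Monsky's `2`-Selmer formula for `E_n`, `n = p₁⋯p_k` ODD, `≥` half, II: every kernel vector of `M` is a Selmer class

For `(x; y) ∈ ker M`, `M = ( A + D₂  D₂ ; D₂  A + D₋₂ )` Monsky's matrix for odd `n = p₁⋯p_k` (appendix to
Heath-Brown, Invent. Math. 118 (1994), typescript p. 39), the pair `(a, b) = (∏ pᵢ^{xᵢ}, ∏ pᵢ^{xᵢ+yᵢ})`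
(`bitProd p x`, `bitProd p (x + y)`; Monsky's positive divisors `a ~ x + n`, `b ~ x − n ~ (x+n)·x`, so that the
tree's second component `x` has exponents `x + y`) has its class `c(a, b)` in `Sel⁽²⁾(E_n/ℚ)`:

* at each `pᵢ` the two `𝔽₂`-relations of `CongruentNumberTwoDescentLocal.lean` are the row relations `rel_a`,
  `rel_b` of `…KernelRelations.lean` (`qr_{pᵢ}(n) = A_ii` for odd `n`);
* at `2` the conditions `χ₄(a) = χ₄(n)χ₄(b)`, `χ₈(b) = 0` (`chi4_rel`, `chi8_rel`) place `([a]₂, [b]₂)` among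
  `(1,1), (5,1), (n,−1), (5n,−1)` — the points `O`, `G = (1/4, √(1−16n²)/8)`, `T₂`, `G + T₂`
  (`CongruentNumberTwoDescentLocalOdd.lean`);
* at `∞`: `a > 0`; at the good primes: `a, b` are units.

Main result: `twoDescentClass_kernel_mem_selmerGroup_odd`. Theorems only; no named fact. Cell `bsd-monsky`
(prover-B); the count is in `CongruentNumberOddMonskySelmerExact.lean`.

## References

* [HeathBrown1994SelmerCongruentII] D. R. Heath-Brown, Invent. Math. 118 (1994) 331–370, Appendix
  (P. Monsky): typescript p. 38 L17 – p. 39 L33 (odd `D`).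
* [SilvermanAEC2009] J. H. Silverman, *The Arithmetic of Elliptic Curves*, 2nd ed., Prop. X.1.4, Prop. X.4.9.
-/

noncomputable section

open scoped Classical

open WeierstrassCurve
open Literature.NumberTheory.GaloisRepresentations
open Literature.NumberTheory.EllipticCurves.KramerTwoDescent
open Literature.NumberTheory.EllipticCurves.TwoDescentLocal
open Literature.NumberTheory.EllipticCurves.HeathBrown1994
open Literature.NumberTheory.EllipticCurves.CongruentNumberEvenMonskySelmer
open Literature.NumberTheory.EllipticCurves.CongruentNumberOddMonskySelmer
open Literature.NumberTheory.EllipticCurves.MonskySelmerCandidates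
open Literature.NumberTheory.EllipticCurves.CongruentNumberTwoDescent
open IsDedekindDomain NumberField Rat.HeightOneSpectrum Matrix

namespace Literature.NumberTheory.EllipticCurves

namespace CongruentNumberOddMonskySelmerKernel

variable {k : ℕ} {p : Fin k → ℕ}

/-! ## §0 Bookkeeping -/

/-- The two values of a bit. [folklore] -/
private theorem zmod2_cases (x : ZMod 2) : x = 0 ∨ x = 1 := by revert x; decide

/-- `1 + 1 = 0` in `ℤ/2`. [folklore] -/
private theorem one_add_one_zmod2 : (1 : ZMod 2) + 1 = 0 := by decide

/-- `chi8` of an odd integer through its class mod `8`. [folklore] -/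
private theorem chi8_intCast' {z : ℤ} (hz : ¬ (2 : ℤ) ∣ z) : chi8 (z : ℚ) = chi8Of (z : ZMod (2 ^ 3)) := by
  rw [chi8, res8_intCast hz]

/-- `χ₄(5) = 0`, `χ₈(5) = 1`, `χ₄(−1) = 1`, `χ₈(−1) = 0` on residues (closed checks). [folklore] -/
private theorem chi_table :
    chi4Of ((5 : ℤ) : ZMod (2 ^ 3)) = 0 ∧ chi8Of ((5 : ℤ) : ZMod (2 ^ 3)) = 1 := by decide

section Selmer

variable (hp : ∀ i, (p i).Prime) (hp2 : ∀ i, p i ≠ 2) (hinj : Function.Injective p)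
variable [hE : (congruentNumberCurve (∏ i, p i)).IsElliptic]

omit hE in
include hp in
/-- `∏ pᵢ ≠ 0`. [folklore] -/
private theorem n_ne_zero : ∏ i, p i ≠ 0 :=
  Finset.prod_ne_zero_iff.mpr fun i _ => (hp i).ne_zero

omit hE in
include hp hp2 in
/-- `n = ∏ pᵢ` is odd. [folklore] -/
private theorem n_mod_two : (∏ i, p i) % 2 = 1 :=
  Nat.odd_iff.mp (Finset.prod_induction _ Odd (fun _ _ ha hb => ha.mul hb) odd_one
    fun i _ => (hp i).odd_of_ne_two (hp2 i))

omit hE in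
/-- `n = ∏ pᵢ` is the all-ones `bitProd`. [folklore] -/
private theorem n_eq_bitProd : ((∏ i, p i : ℕ) : ℚ) = (bitProd p (fun _ => 1) : ℚ) := by
  rw [cast_bitProd]; push_cast; simp

omit hE in
include hp hinj in
/-- `v_{pᵢ}(n) = 1` for `n = ∏ pⱼ`. [folklore] -/
private theorem padicValRat_n (i : Fin k) :
    haveI : Fact (p i).Prime := ⟨hp i⟩
    padicValRat (p i) ((∏ j, p j : ℕ) : ℚ) = 1 := by
  haveI : Fact (p i).Prime := ⟨hp i⟩
  rw [n_eq_bitProd, padicValRat_bitProd_self hp hinj _ i]; simp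

omit hE in
include hp hp2 hinj in
/-- `χ₄(n) = Σ uⱼ`, `χ₈(n) = Σ wⱼ` for `n = ∏ pⱼ`. [folklore] -/
private theorem chi_n :
    chi4 ((∏ j, p j : ℕ) : ℚ) = ∑ j, addLegendreSym (-1) (p j) ∧
      chi8 ((∏ j, p j : ℕ) : ℚ) = ∑ j, addLegendreSym 2 (p j) := by
  rw [n_eq_bitProd, chi4_bitProd hp hp2 hinj, chi8_bitProd hp hp2]
  exact ⟨by simp, by simp⟩

include hp hp2 hinj in
/-- **Every kernel vector of Monsky's ODD matrix gives a Selmer class.** For `(x; y)` with `M(x; y) = 0`, the class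
`c(a, b)` of `a = ∏ pᵢ^{xᵢ}`, `b = ∏ pᵢ^{xᵢ+yᵢ}` lies in `Sel⁽²⁾(E_n/ℚ)`, `n = p₁⋯p_k` odd: it is everywhere locally a
descent pair — at the `pᵢ` by `rel_a`/`rel_b`, at `2` by `χ₄(a) = χ₄(n)χ₄(b)`, `χ₈(b) = 0` (the pair is `2`-adically
`(1,1)`, `(5,1)`, `(n,−1)` or `(5n,−1)`: the points `O`, `G`, `T₂`, `G + T₂`), at `∞` since `a > 0`, at the good primes
since `a, b` are units there. [cite: HeathBrown1994SelmerCongruentII, Appendix (Monsky), typescript p. 38 L17 – p. 39 L33]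
[cite: SilvermanAEC2009, Prop. X.1.4, Prop. X.4.9] -/
theorem twoDescentClass_kernel_mem_selmerGroup_odd {x y : Fin k → ZMod 2}
    (hx : monskyMatrixOdd p *ᵥ Sum.elim x y = 0) :
    (congruentNumberCurve (∏ i, p i)).twoDescentClass (splitTwoTorsion_cn (∏ i, p i))
        (Units.mk0 (bitProd p x : ℚ) (cast_bitProd_ne_zero hp x))
        (Units.mk0 (bitProd p (x + y) : ℚ) (cast_bitProd_ne_zero hp (x + y))) ∈
      (congruentNumberCurve (∏ i, p i)).selmerGroup 2 := by
  haveI : Fact (Nat.Prime 2) := ⟨Nat.prime_two⟩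
  have hU := chi4_rel hp hp2 hinj hx
  have hW := chi8_rel hp hp2 hinj hx
  refine twoDescentClass_mem_selmerGroup_of_local (n_ne_zero hp) _ _ (bitProd p x : ℤ) (bitProd p (x + y) : ℤ)
    (by push_cast; rfl) (by push_cast; rfl) (by rw [Units.val_mk0]; exact_mod_cast bitProd_pos hp x) ?_ ?_ ?_
  · -- good odd primes
    intro ℓ hℓ _ hℓn
    constructor
    · intro h
      obtain ⟨i, -, hi⟩ := exists_eq_of_prime_dvd_bitProd hp x hℓ (by exact_mod_cast h)
      exact hℓn (hi ▸ Finset.dvd_prod_of_mem p (Finset.mem_univ i))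
    · intro h
      obtain ⟨i, -, hi⟩ := exists_eq_of_prime_dvd_bitProd hp (x + y) hℓ (by exact_mod_cast h)
      exact hℓn (hi ▸ Finset.dvd_prod_of_mem p (Finset.mem_univ i))
  · -- the odd primes `ℓ ∣ n`: `ℓ = p i`
    intro ℓ hℓ _ hℓn
    obtain ⟨i, -, hi⟩ := (Prime.dvd_finsetProd_iff hℓ.prime _).mp hℓn
    have hℓi : p i = ℓ := ((Nat.prime_dvd_prime_iff_eq hℓ (hp i)).mp hi).symm
    subst hℓi
    haveI : Fact (p i).Prime := ⟨hp i⟩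
    refine ⟨padicValRat_n hp hinj i, ?_, ?_⟩
    · rw [Units.val_mk0, Units.val_mk0, qrBit_bitProd hp hp2 hinj, parityBit_bitProd hp hinj,
        parityBit_bitProd hp hinj, qrBit_n_odd hp hinj i, qrBit_two_eq_addLegendreSym (hp2 i), rel_a hx i]
      rfl
    · rw [Units.val_mk0, Units.val_mk0, qrBit_bitProd hp hp2 hinj, parityBit_bitProd hp hinj,
        parityBit_bitProd hp hinj, qrBit_n_odd hp hinj i, qrBit_neg_one_eq_addLegendreSym]
      rw [show (∑ j ∈ Finset.univ.erase i, addLegendreSym (p j) (p i) * (x + y) j) =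
          ∑ j ∈ Finset.univ.erase i, addLegendreSym (p j) (p i) * (x j + y j) from rfl, rel_b hp hp2 hx i]
      rfl
  · -- the prime `2`
    intro v hv
    have hva : padicValRat 2 (bitProd p x : ℚ) = 0 := padicValRat_bitProd_of_forall_ne hp hinj x Nat.prime_two hp2
    have hvb : padicValRat 2 (bitProd p (x + y) : ℚ) = 0 :=
      padicValRat_bitProd_of_forall_ne hp hinj (x + y) Nat.prime_two hp2
    have ha0 := cast_bitProd_ne_zero hp x
    have hb0 := cast_bitProd_ne_zero hp (x + y)
    have hn0 : ((∏ i, p i : ℕ) : ℚ) ≠ 0 := by exact_mod_cast n_ne_zero hp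
    set N : ℚ := ((∏ i, p i : ℕ) : ℚ) with hN
    -- the data: `χ₄(a) = U·χ₄(b)`, `χ₈(b) = 0`, `χ₈(a)` free
    have h4a : chi4 (bitProd p x : ℚ) = (∑ j, addLegendreSym (-1) (p j)) * chi4 (bitProd p (x + y) : ℚ) := by
      rw [chi4_bitProd hp hp2 hinj, chi4_bitProd hp hp2 hinj, hU]; rfl
    have h8b : chi8 (bitProd p (x + y) : ℚ) = 0 := by rw [chi8_bitProd hp hp2]; exact hW
    obtain ⟨c4N, c8N⟩ := chi_n (p := p) hp hp2 hinj
    -- `1 + 4n ≡ 5 (mod 8)`: `χ₄ = 0`, `χ₈ = 1`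
    have h14 : chi4 ((1 : ℚ) + 4 * N) = 0 ∧ chi8 ((1 : ℚ) + 4 * N) = 1 := by
      have hodd : ¬ (2 : ℤ) ∣ (1 + 4 * (∏ i, p i : ℕ) : ℤ) := by omega
      have hcast : (1 : ℚ) + 4 * N = ((1 + 4 * (∏ i, p i : ℕ) : ℤ) : ℚ) := by rw [hN]; push_cast; ring
      have hmod : (1 + 4 * (∏ i, p i : ℕ) : ℤ) % 8 = 5 := by have := n_mod_two hp hp2; omega
      have hc : ((1 + 4 * (∏ i, p i : ℕ) : ℤ) : ZMod (2 ^ 3)) = ((5 : ℤ) : ZMod (2 ^ 3)) := by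
        have hc1 : ((1 + 4 * (∏ i, p i : ℕ) : ℤ) : ZMod (2 ^ 3)) =
            (((1 + 4 * (∏ i, p i : ℕ)) % 8 : ℤ) : ZMod (2 ^ 3)) := by
          rw [show (2 : ℕ) ^ 3 = 8 from rfl]; exact (ZMod.intCast_mod _ 8).symm
        rw [hc1, hmod]
      rw [hcast, chi4_intCast hodd, chi8_intCast' hodd, hc]
      exact chi_table
    have hm1 : chi4 (-1 : ℚ) = 1 ∧ chi8 (-1 : ℚ) = 0 := ⟨chi4_neg_one, chi8_neg_one⟩
    rcases zmod2_cases (chi4 (bitProd p (x + y) : ℚ)) with hUb | hUb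
    · -- `χ₄(b) = 0`: `b ≡ 1`, `a ≡ 1` or `5`
      rw [hUb, mul_zero] at h4a
      have h8bres : res8 (bitProd p (x + y) : ℚ) = 1 := res8_eq_one_of_chi4_chi8 hb0 hUb h8b
      rcases zmod2_cases (chi8 (bitProd p x : ℚ)) with h8a | h8a
      · -- the point `O`
        exact twoDescentClass_mem_selmerLocalKer_two_of_res8_eq_one v hv _ _ hva hvb
          (res8_eq_one_of_chi4_chi8 ha0 h4a h8a) h8bres
      · -- the point `G`: `a ≡ 5 ≡ 1 + 4n`
        refine twoDescentClass_mem_selmerLocalKer_two_of_G_res8 v hv _ _ hva hvb ?_ h8bres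
        rw [Units.val_mk0]
        exact res8_mul_eq_one_of_eq ha0 (by positivity)
          (res8_eq_of_chi4_chi8 ha0 (by positivity) (by rw [h4a, h14.1]) (by rw [h8a, h14.2]))
    · -- `χ₄(b) = 1`: `b ≡ 7`, `a·n ≡ 1` or `5`
      rw [hUb, mul_one] at h4a
      have hmb : res8 (-(bitProd p (x + y) : ℚ)) = 1 := by
        rw [show (-(bitProd p (x + y) : ℚ)) = -1 * (bitProd p (x + y) : ℚ) by ring]
        exact res8_eq_one_of_chi4_chi8 (mul_ne_zero (by norm_num) hb0)
          (by rw [chi4_mul (by norm_num) hb0, hm1.1, hUb]; exact one_add_one_zmod2)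
          (by rw [chi8_mul (by norm_num) hb0, hm1.2, h8b, zero_add])
      have h4an : chi4 ((bitProd p x : ℚ) * N) = 0 := by
        rw [chi4_mul ha0 hn0, h4a, c4N]; exact CharTwo.add_self_eq_zero _
      rcases zmod2_cases (chi8 ((bitProd p x : ℚ) * N)) with h8 | h8
      · -- the point `T₂`
        exact twoDescentClass_mem_selmerLocalKer_two_of_T₂_res8 (n_mod_two hp hp2) v hv _ _ hva hvb
          (res8_eq_one_of_chi4_chi8 (mul_ne_zero ha0 hn0) h4an h8) hmb
      · -- the point `G + T₂`: `a·n ≡ 5 ≡ 1 + 4n`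
        refine twoDescentClass_mem_selmerLocalKer_two_of_GT₂_res8 (n_mod_two hp hp2) v hv _ _ hva hvb ?_ hmb
        rw [Units.val_mk0]
        exact res8_mul_eq_one_of_eq (mul_ne_zero ha0 hn0) (by positivity)
          (res8_eq_of_chi4_chi8 (mul_ne_zero ha0 hn0) (by positivity) (by rw [h4an, h14.1]) (by rw [h8, h14.2]))

end Selmer

end CongruentNumberOddMonskySelmerKernel

end Literature.NumberTheory.EllipticCurves

end
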